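import Literature.AlgebraicGeometry.Frobenioids.BiratUnitsDiv
import Literature.AlgebraicGeometry.Frobenioids.BiratGerms
import HarnessLib

/-!
# Frobenioids I, Proposition 4.4 (iii): the image of `O^×(A^birat) → Φ^gp(A)` is `Φ^birat(A)` (bridge)

Mochizuki, *The geometry of Frobenioids I: the general theory*, Kyushu J. Math. **62** (2008)
293–400, §4, Proposition 4.4 (iii), kurims text p. 83 [cite: MochizukiFrdI2008, Prop. 4.4(iii) p.83]:
"the resulting functor `C^birat → F_{Φ^birat}` induces, for each `A^birat ∈ Ob(C^birat)`, a surjection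
`O^×(A^birat) ↠ Φ^birat(A^birat)`, whose kernel is the image … of `O^×(A)`."

The bridge demanded by L1-lead RULING C5′: the image `BiratUnits.divHomRange` of the divisor map
`divHom : O^×(A^birat) → Φ^gp(A)` (`BiratUnitsDiv.lean`, seat abc-iut-L6-t8) coincides with the value at
`Base A` of the CANONICAL subfunctor `Φ^birat ⊆ Φ^gp` (`biratSubfunctor`, seat abc-iut-L1-t5,
`BiratSubfunctor.lean`): as sets both are the *birational germs* (`mem_divHomRange_iff` here,
`coe_biratSubfunctor_baseObj` of `BiratGerms.lean`, seat abc-iut-L1-t10 — the latter for Frobenioids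
of isotropic type).  Together with `ker_divHom_eq_range` this is the exact sequence
`1 → O^×(A) → O^×(A^birat) → Φ^birat(A) → 1` of Prop. 4.4 (iii) with the canonical `Φ^birat`.
Proof-only file.
-/

namespace Literature.AlgebraicGeometry.Frobenioids

open CategoryTheory Opposite

universe w v v' u u'

namespace PreFrobenioid

namespace BiratUnits

variable {D : Type u} [Category.{v} D] {Φ : Dᵒᵖ ⥤ CommMonCat.{w}}
  {C : Type u'} [Category.{v'} C] {F : C ⥤ ElemFrobenioid Φ} {hF : IsFrobenioid F} {A : C}

variable (hF A) in
/-- The image of `O^×(A^birat) → Φ^gp(A)` is, as a set, the set of birational germs at `A`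
(`(φ^*)⁻¹Div φ − (α^*)⁻¹Div α`). [cite: MochizukiFrdI2008, Prop. 4.4(iii) p.83] -/
theorem coe_divHomRange_eq_biratGerms :
    ((divHomRange hF A : Subgroup (PhiGp F A)) : Set (PhiGp F A)) = biratGerms F A := by
  ext x
  rw [SetLike.mem_coe, mem_divHomRange_iff]
  rfl

variable (hF A) in
/-- **Prop. 4.4 (iii)** (bridge, RULING C5′): for a Frobenioid of isotropic type, the image of the
divisor map `O^×(A^birat) → Φ^gp(A)` IS `Φ^birat(Base A)`, the value of the canonical subfunctor
`Φ^birat ⊆ Φ^gp` — i.e. `O^×(A^birat) ↠ Φ^birat(A^birat)` is surjective.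
[cite: MochizukiFrdI2008, Prop. 4.4(iii) p.83] -/
theorem range_divHom_eq_biratSubgroup (hiso : IsOfIsotropicType F) :
    (divHom hF A).range = biratSubgroup F (baseObj F A) := by
  apply SetLike.coe_injective
  change ((divHomRange hF A : Subgroup (PhiGp F A)) : Set (PhiGp F A)) =
    ((biratSubfunctor F).carrier (baseObj F A) : Set _)
  rw [coe_divHomRange_eq_biratGerms, coe_biratSubfunctor_baseObj F hF hiso A]

variable (hF A) in
/-- **Prop. 4.4 (iii)**, surjectivity onto the canonical `Φ^birat(A)`: every element of `Φ^birat(Base A)`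
is the divisor of a rational function at `A` (isotropic type).
[cite: MochizukiFrdI2008, Prop. 4.4(iii) p.83] -/
theorem divHom_surjective_biratSubgroup (hiso : IsOfIsotropicType F) (c : PhiGp F A)
    (hc : c ∈ biratSubgroup F (baseObj F A)) : ∃ u : BiratUnits F hF A, divHom hF A u = c := by
  rw [← range_divHom_eq_biratSubgroup hF A hiso] at hc
  exact hc

end BiratUnits

end PreFrobenioid

end Literature.AlgebraicGeometry.Frobenioids
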